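import Literature.Topology.FourManifolds.GluingConstruction
import Literature.Geometry.Manifold.EmbeddingRangeDiffeomorph
import Literature.Geometry.Manifold.BilinSectionGluing
import Literature.Geometry.Manifold.OpenSubmanifoldMFDeriv
import Literature.Geometry.Lorentzian.IsometryProofs
import HarnessLib

/-!
# Metrics descend to an open gluing

Topic `Literature/Topology/FourManifolds` (it extends `SmoothGlueData`). Let `P = A ∪_ψ B` be the
open gluing (pushout) of two boundaryless manifolds along a partial diffeomorphism `ψ : U ≅ V`, `U ⊆ A`, `V ⊆ B` open
(`Literature.Topology.FourManifolds.SmoothGlueData.Glued`, Kosinski, *Differential Manifolds*,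
VI.1), with its open smooth embeddings `inl : A → P`, `inr : B → P`. If `A` and `B` carry
pseudo-Riemannian metrics `g_A`, `g_B` for which **the gluing map is an isometry**,
`g_B(dψ v, dψ w) = g_A(v, w)` on `U`, then there is a pseudo-Riemannian metric `g` on `P` with
`inl^* g = g_A` and `inr^* g = g_B` (`exists_metric_of_glue_isometry`); it is Riemannian when
`g_A`, `g_B` are (`isRiemannian_of_glue`). This is the standard way a metric is put on a manifold
built by gluing (O'Neill 1983, Ch. 3, pp. 90–91: a local diffeomorphism pulls back metrics, and a
tensor field is determined by its restrictions to an open cover, Ch. 2, pp. 36–37); it is the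
metric half of Bray's compactification `(M ∪ {∞}, g̃)` (J. Differential Geom. 59 (2001), proof of
Thm. 8) and of the reflection double of Thm. 9, both open gluings.

Proof: the pieces `inl(A)`, `inr(B)` are open submanifolds of `P`, diffeomorphic to `A`, `B`
through `inl`, `inr` (`Manifold.exists_diffeomorph_comp_eq_of_range_eq`, Lee Thm. 5.31); pull
`g_A`, `g_B` back to them along the inverse diffeomorphisms (`PseudoRiemannianMetric.comap`);
on the overlap the two pulled-back fields agree because `inr ∘ ψ = inl` near every point of `U`
(chain rule) and `ψ` is an isometry; glue with the sheaf property of tensor fields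
(`OpenSubmanifold.exists_pseudoRiemannianMetric_of_openCover`). The differentials of `inl`,
`inr` are bijective (`mfderiv_inl_bijective`), which transfers positivity.

Everything is proved; no definitions, no named facts.

## References

* B. O'Neill, *Semi-Riemannian Geometry with Applications to Relativity* (1983), Ch. 3,
  pp. 90–91; Ch. 2, pp. 36–37. [ONeill1983]
* A. A. Kosinski, *Differential Manifolds* (1993), VI.1. [Kosinski1993]
* H. L. Bray, *Proof of the Riemannian Penrose inequality using the positive mass theorem*,
  J. Differential Geom. 59 (2001) 177–267, §6, proofs of Thms. 8 and 9. [BrayRPI2001]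
-/

noncomputable section

open Set Function TopologicalSpace Filter
open scoped Manifold ContDiff Topology

namespace Literature.Topology.FourManifolds

open Literature.Geometry.Lorentzian Literature.Geometry.Lorentzian.PseudoRiemannianMetric
  Literature.Geometry.Manifold

/-! ### Two chain-rule identities for diffeomorphisms -/

section Diffeo

variable {EM : Type*} [NormedAddCommGroup EM] [NormedSpace ℝ EM] {HM : Type*} [TopologicalSpace HM]
  {J : ModelWithCorners ℝ EM HM} {M : Type*} [TopologicalSpace M] [ChartedSpace HM M]
  {EN : Type*} [NormedAddCommGroup EN] [NormedSpace ℝ EN] {HN : Type*} [TopologicalSpace HN]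
  {J' : ModelWithCorners ℝ EN HN} {N : Type*} [TopologicalSpace N] [ChartedSpace HN N]

/-- For a diffeomorphism `θ`, `dθ⁻¹_{θ x} (dθ_x v) = v` (chain rule for `θ⁻¹ ∘ θ = id`).
[folklore] -/
theorem mfderiv_symm_apply_mfderiv (θ : M ≃ₘ^∞⟮J, J'⟯ N) (x : M) (v : TangentSpace J x) :
    mfderiv J' J θ.symm (θ x) (mfderiv J J' θ x v) = v := by
  have hθmd : MDifferentiableAt J J' θ x := θ.contMDiff.mdifferentiableAt (by simp)
  have hθsmd : MDifferentiableAt J' J θ.symm (θ x) := θ.symm.contMDiff.mdifferentiableAt (by simp)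
  have h := mfderiv_comp x hθsmd hθmd
  have hid : ((θ.symm : N → M) ∘ (θ : M → N)) = id := funext fun x' ↦ θ.symm_apply_apply x'
  rw [hid, mfderiv_id] at h
  exact (DFunLike.congr_fun h v).symm

/-- For a diffeomorphism `θ`, `dθ_{θ⁻¹ y} (dθ⁻¹_y v) = v` (chain rule for `θ ∘ θ⁻¹ = id`).
[folklore] -/
theorem mfderiv_apply_mfderiv_symm (θ : M ≃ₘ^∞⟮J, J'⟯ N) (y : N) (v : TangentSpace J' y) :
    mfderiv J J' θ (θ.symm y) (mfderiv J' J θ.symm y v) = v := by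
  have hθmd : MDifferentiableAt J J' θ (θ.symm y) := θ.contMDiff.mdifferentiableAt (by simp)
  have hθsmd : MDifferentiableAt J' J θ.symm y := θ.symm.contMDiff.mdifferentiableAt (by simp)
  have h := mfderiv_comp y hθmd hθsmd
  have hid : ((θ : M → N) ∘ (θ.symm : N → M)) = id := funext fun y' ↦ θ.apply_symm_apply y'
  rw [hid, mfderiv_id] at h
  exact (DFunLike.congr_fun h v).symm

end Diffeo

namespace SmoothGlueData

universe uA uB

variable {E_A H_A E_B H_B : Type*}
  [NormedAddCommGroup E_A] [NormedSpace ℝ E_A] [TopologicalSpace H_A]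
  [NormedAddCommGroup E_B] [NormedSpace ℝ E_B] [TopologicalSpace H_B]
  {I_A : ModelWithCorners ℝ E_A H_A} {I_B : ModelWithCorners ℝ E_B H_B}
  {A : Type uA} [TopologicalSpace A] [ChartedSpace H_A A]
  {B : Type uB} [TopologicalSpace B] [ChartedSpace H_B B]
  {E_P : Type*} [NormedAddCommGroup E_P] [NormedSpace ℝ E_P]
  (d : SmoothGlueData I_A I_B A B E_P)
  [I_A.Boundaryless] [I_B.Boundaryless] [IsManifold I_A ∞ A] [IsManifold I_B ∞ B]

/-! ### The pieces as open submanifolds, parametrised by `A` and `B` -/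

/-- **The piece `inl(A)` is diffeomorphic to `A` through `inl`**: there is a diffeomorphism
`θ : A ≅ inl(A)` (onto the open submanifold `range inl` of the glued space) with `↑(θ a) = inl a`
(Lee 2013, Thm. 5.31, via `Manifold.exists_diffeomorph_comp_eq_of_range_eq`). [folklore] -/
theorem exists_diffeomorph_inl :
    ∃ θ : A ≃ₘ^∞⟮I_A, 𝓘(ℝ, E_P)⟯ (⟨range d.inl, d.isOpen_range_inl⟩ : Opens d.Glued),
      ∀ a, ((θ a : (⟨range d.inl, d.isOpen_range_inl⟩ : Opens d.Glued)) : d.Glued) = d.inl a := by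
  set UA : Opens d.Glued := ⟨range d.inl, d.isOpen_range_inl⟩
  have hrA : range d.inl = range (Subtype.val : UA → d.Glued) := by
    apply subset_antisymm
    · rintro _ ⟨a, rfl⟩
      exact ⟨⟨d.inl a, ⟨a, rfl⟩⟩, rfl⟩
    · rintro _ ⟨p, rfl⟩
      exact p.2
  exact exists_diffeomorph_comp_eq_of_range_eq d.isSmoothEmbedding_inl
    (Manifold.IsSmoothEmbedding.of_opens UA) hrA

/-- **The piece `inr(B)` is diffeomorphic to `B` through `inr`.** [folklore] -/
theorem exists_diffeomorph_inr :
    ∃ θ : B ≃ₘ^∞⟮I_B, 𝓘(ℝ, E_P)⟯ (⟨range d.inr, d.isOpen_range_inr⟩ : Opens d.Glued),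
      ∀ b, ((θ b : (⟨range d.inr, d.isOpen_range_inr⟩ : Opens d.Glued)) : d.Glued) = d.inr b := by
  set UB : Opens d.Glued := ⟨range d.inr, d.isOpen_range_inr⟩
  have hrB : range d.inr = range (Subtype.val : UB → d.Glued) := by
    apply subset_antisymm
    · rintro _ ⟨b, rfl⟩
      exact ⟨⟨d.inr b, ⟨b, rfl⟩⟩, rfl⟩
    · rintro _ ⟨p, rfl⟩
      exact p.2
  exact exists_diffeomorph_comp_eq_of_range_eq d.isSmoothEmbedding_inr
    (Manifold.IsSmoothEmbedding.of_opens UB) hrB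

/-- The differential of `inl` equals the differential of the parametrisation `θ` of the piece
`inl(A)` (the inclusion of an open submanifold has identity differential). [folklore] -/
theorem mfderiv_inl_eq_of_diffeomorph {UA : Opens d.Glued} (θ : A ≃ₘ^∞⟮I_A, 𝓘(ℝ, E_P)⟯ UA)
    (hθ : ∀ a, ((θ a : UA) : d.Glued) = d.inl a) (a : A) (v : TangentSpace I_A a) :
    mfderiv I_A 𝓘(ℝ, E_P) d.inl a v = mfderiv I_A 𝓘(ℝ, E_P) θ a v := by
  have hev : (d.inl : A → d.Glued) =ᶠ[𝓝 a] (Subtype.val ∘ θ) :=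
    Filter.Eventually.of_forall fun a' ↦ (hθ a').symm
  have hθmd : MDifferentiableAt I_A 𝓘(ℝ, E_P) θ a := θ.contMDiff.mdifferentiableAt (by simp)
  rw [hev.mfderiv_eq, mfderiv_comp a (OpenSubmanifold.mdifferentiableAt_subtype_val _) hθmd,
    OpenSubmanifold.mfderiv_subtype_val]
  rfl

/-- The differential of `inr` equals the differential of the parametrisation of `inr(B)`.
[folklore] -/
theorem mfderiv_inr_eq_of_diffeomorph {UB : Opens d.Glued} (θ : B ≃ₘ^∞⟮I_B, 𝓘(ℝ, E_P)⟯ UB)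
    (hθ : ∀ b, ((θ b : UB) : d.Glued) = d.inr b) (b : B) (v : TangentSpace I_B b) :
    mfderiv I_B 𝓘(ℝ, E_P) d.inr b v = mfderiv I_B 𝓘(ℝ, E_P) θ b v := by
  have hev : (d.inr : B → d.Glued) =ᶠ[𝓝 b] (Subtype.val ∘ θ) :=
    Filter.Eventually.of_forall fun b' ↦ (hθ b').symm
  have hθmd : MDifferentiableAt I_B 𝓘(ℝ, E_P) θ b := θ.contMDiff.mdifferentiableAt (by simp)
  rw [hev.mfderiv_eq, mfderiv_comp b (OpenSubmanifold.mdifferentiableAt_subtype_val _) hθmd,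
    OpenSubmanifold.mfderiv_subtype_val]
  rfl

/-- **`inl` and `inr ∘ ψ` have the same differential on the gluing region**: for `a ∈ U`,
`d(inl)_a v = d(inr)_{ψ a} (dψ_a v)` (`inr ∘ ψ = inl` near `a`, chain rule). [folklore] -/
theorem mfderiv_inl_eq_mfderiv_inr_glue {a : A} (ha : a ∈ d.glue.source) (v : TangentSpace I_A a) :
    mfderiv I_A 𝓘(ℝ, E_P) d.inl a v =
      mfderiv I_B 𝓘(ℝ, E_P) d.inr (d.glue a) (mfderiv I_A I_B d.glue a v) := by
  have hev : (d.inl : A → d.Glued) =ᶠ[𝓝 a] (d.inr ∘ d.glue) := by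
    filter_upwards [d.glue.open_source.mem_nhds ha] with a' ha'
    exact (d.inr_glue ha').symm
  have hglue : MDifferentiableAt I_A I_B d.glue a :=
    (d.contMDiffOn_glue.contMDiffAt (d.glue.open_source.mem_nhds ha)).mdifferentiableAt (by simp)
  have hinr : MDifferentiableAt I_B 𝓘(ℝ, E_P) d.inr (d.glue a) :=
    d.contMDiff_inr.mdifferentiableAt (by simp)
  rw [hev.mfderiv_eq, mfderiv_comp a hinr hglue]
  rfl

/-- **The differential of `inl` is bijective** (an open smooth embedding between manifolds of
the same dimension is a local diffeomorphism). [folklore] -/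
theorem mfderiv_inl_bijective (a : A) : Function.Bijective (mfderiv I_A 𝓘(ℝ, E_P) d.inl a) := by
  obtain ⟨θ, hθ⟩ := d.exists_diffeomorph_inl
  have hfun : mfderiv I_A 𝓘(ℝ, E_P) d.inl a = mfderiv I_A 𝓘(ℝ, E_P) θ a :=
    ContinuousLinearMap.ext fun v ↦ d.mfderiv_inl_eq_of_diffeomorph θ hθ a v
  rw [hfun]
  exact (θ.mfderivToContinuousLinearEquiv (by simp) a).bijective

/-- **The differential of `inr` is bijective.** [folklore] -/
theorem mfderiv_inr_bijective (b : B) : Function.Bijective (mfderiv I_B 𝓘(ℝ, E_P) d.inr b) := by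
  obtain ⟨θ, hθ⟩ := d.exists_diffeomorph_inr
  have hfun : mfderiv I_B 𝓘(ℝ, E_P) d.inr b = mfderiv I_B 𝓘(ℝ, E_P) θ b :=
    ContinuousLinearMap.ext fun v ↦ d.mfderiv_inr_eq_of_diffeomorph θ hθ b v
  rw [hfun]
  exact (θ.mfderivToContinuousLinearEquiv (by simp) b).bijective

/-! ### Gluing the metrics -/

/-- **Metrics for which the gluing map is an isometry descend to the glued manifold.** Let
`g_A`, `g_B` be `C^∞` pseudo-Riemannian metrics on `A`, `B` with
`g_B(dψ_a v, dψ_a w) = g_A(v, w)` for `a` in the gluing region. Then the open gluing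
`P = A ∪_ψ B` carries a `C^∞` pseudo-Riemannian metric `g` with `inl^* g = g_A` and
`inr^* g = g_B`: `g(d(inl) v, d(inl) w) = g_A(v, w)` and `g(d(inr) v, d(inr) w) = g_B(v, w)`
(O'Neill 1983, Ch. 3, pp. 90–91 with Ch. 2, pp. 36–37; the metric on Bray's `M ∪ {∞_k}`,
proof of Thm. 8, and on the reflection double, proof of Thm. 9).
[cite: ONeill1983, Ch. 3, pp. 90–91] -/
theorem exists_metric_of_glue_isometry
    [FiniteDimensional ℝ E_A] [FiniteDimensional ℝ E_B] [FiniteDimensional ℝ E_P]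
    (gA : PseudoRiemannianMetric I_A ∞ E_A (TangentSpace I_A : A → Type _))
    (gB : PseudoRiemannianMetric I_B ∞ E_B (TangentSpace I_B : B → Type _))
    (hiso : ∀ a ∈ d.glue.source, ∀ v w : TangentSpace I_A a,
      gB.val (d.glue a) (mfderiv I_A I_B d.glue a v) (mfderiv I_A I_B d.glue a w) = gA.val a v w) :
    ∃ g : PseudoRiemannianMetric 𝓘(ℝ, E_P) ∞ E_P (TangentSpace 𝓘(ℝ, E_P) : d.Glued → Type _),
      (∀ (a : A) (v w : TangentSpace I_A a),
        g.val (d.inl a) (mfderiv I_A 𝓘(ℝ, E_P) d.inl a v) (mfderiv I_A 𝓘(ℝ, E_P) d.inl a w) =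
          gA.val a v w) ∧
      (∀ (b : B) (v w : TangentSpace I_B b),
        g.val (d.inr b) (mfderiv I_B 𝓘(ℝ, E_P) d.inr b v) (mfderiv I_B 𝓘(ℝ, E_P) d.inr b w) =
          gB.val b v w) := by
  classical
  -- the pieces and their parametrisations
  set UA : Opens d.Glued := ⟨range d.inl, d.isOpen_range_inl⟩ with hUA_def
  set UB : Opens d.Glued := ⟨range d.inr, d.isOpen_range_inr⟩ with hUB_def
  obtain ⟨θA, hθA⟩ := d.exists_diffeomorph_inl
  obtain ⟨θB, hθB⟩ := d.exists_diffeomorph_inr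
  have hdimA : Module.finrank ℝ E_P = Module.finrank ℝ E_A := d.linA.symm.toLinearEquiv.finrank_eq
  have hdimB : Module.finrank ℝ E_P = Module.finrank ℝ E_B := d.linB.symm.toLinearEquiv.finrank_eq
  have hθAs : ContMDiff 𝓘(ℝ, E_P) I_A ∞ θA.symm := θA.symm.contMDiff
  have hθBs : ContMDiff 𝓘(ℝ, E_P) I_B ∞ θB.symm := θB.symm.contMDiff
  have hθAinj : ∀ p, Function.Injective (mfderiv 𝓘(ℝ, E_P) I_A θA.symm p) := fun p v w h ↦ by
    have h' := congrArg (mfderiv I_A 𝓘(ℝ, E_P) θA (θA.symm p)) h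
    rwa [mfderiv_apply_mfderiv_symm θA p v, mfderiv_apply_mfderiv_symm θA p w] at h'
  have hθBinj : ∀ p, Function.Injective (mfderiv 𝓘(ℝ, E_P) I_B θB.symm p) := fun p v w h ↦ by
    have h' := congrArg (mfderiv I_B 𝓘(ℝ, E_P) θB (θB.symm p)) h
    rwa [mfderiv_apply_mfderiv_symm θB p v, mfderiv_apply_mfderiv_symm θB p w] at h'
  -- the metrics on the pieces
  set g₁ : PseudoRiemannianMetric 𝓘(ℝ, E_P) ∞ E_P (TangentSpace 𝓘(ℝ, E_P) : UA → Type _) :=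
    gA.comap contMDiff_pullbackBilin_holds θA.symm hθAs hθAinj hdimA with hg₁_def
  set g₂ : PseudoRiemannianMetric 𝓘(ℝ, E_P) ∞ E_P (TangentSpace 𝓘(ℝ, E_P) : UB → Type _) :=
    gB.comap contMDiff_pullbackBilin_holds θB.symm hθBs hθBinj hdimB with hg₂_def
  -- compatibility on the overlap
  have hcompat : ∀ (p : d.Glued) (h1 : p ∈ UA) (h2 : p ∈ UB),
      (g₁.val ⟨p, h1⟩ : E_P →L[ℝ] E_P →L[ℝ] ℝ) = g₂.val ⟨p, h2⟩ := by
    intro p h1 h2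
    -- the preimages `a`, `b` of `p`
    set a : A := θA.symm ⟨p, h1⟩ with ha_def
    set b : B := θB.symm ⟨p, h2⟩ with hb_def
    have hpa : θA a = ⟨p, h1⟩ := θA.apply_symm_apply _
    have hpb : θB b = ⟨p, h2⟩ := θB.apply_symm_apply _
    have hinla : d.inl a = p := by rw [← hθA a, hpa]
    have hinrb : d.inr b = p := by rw [← hθB b, hpb]
    obtain ⟨hsrc, hglue⟩ := d.inl_eq_inr_iff.1 (hinla.trans hinrb.symm)
    ext v w
    -- the vectors `v`, `w` come from `T_a A`
    set v' : TangentSpace I_A a := mfderiv 𝓘(ℝ, E_P) I_A θA.symm ⟨p, h1⟩ v with hv'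
    set w' : TangentSpace I_A a := mfderiv 𝓘(ℝ, E_P) I_A θA.symm ⟨p, h1⟩ w with hw'
    have hv : mfderiv I_A 𝓘(ℝ, E_P) d.inl a v' = v := by
      rw [d.mfderiv_inl_eq_of_diffeomorph θA hθA a v', hv']
      have := mfderiv_apply_mfderiv_symm θA ⟨p, h1⟩ v
      rwa [← ha_def] at this
    have hw : mfderiv I_A 𝓘(ℝ, E_P) d.inl a w' = w := by
      rw [d.mfderiv_inl_eq_of_diffeomorph θA hθA a w', hw']
      have := mfderiv_apply_mfderiv_symm θA ⟨p, h1⟩ w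
      rwa [← ha_def] at this
    -- and then `dθB⁻¹ v = dψ v'`
    have hpb' : θB (d.glue a) = ⟨p, h2⟩ := by rw [hglue]; exact hpb
    have hbg : θB.symm ⟨p, h2⟩ = d.glue a := (hglue.trans hb_def).symm
    have hvB : mfderiv 𝓘(ℝ, E_P) I_B θB.symm ⟨p, h2⟩ v = mfderiv I_A I_B d.glue a v' := by
      rw [← hv, d.mfderiv_inl_eq_mfderiv_inr_glue hsrc,
        d.mfderiv_inr_eq_of_diffeomorph θB hθB (d.glue a) (mfderiv I_A I_B d.glue a v'), ← hpb']
      exact mfderiv_symm_apply_mfderiv θB (d.glue a) _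
    have hwB : mfderiv 𝓘(ℝ, E_P) I_B θB.symm ⟨p, h2⟩ w = mfderiv I_A I_B d.glue a w' := by
      rw [← hw, d.mfderiv_inl_eq_mfderiv_inr_glue hsrc,
        d.mfderiv_inr_eq_of_diffeomorph θB hθB (d.glue a) (mfderiv I_A I_B d.glue a w'), ← hpb']
      exact mfderiv_symm_apply_mfderiv θB (d.glue a) _
    -- transport of the base point `θB⁻¹ p = ψ a` together with the vectors
    have key : gB.val (θB.symm ⟨p, h2⟩) (mfderiv 𝓘(ℝ, E_P) I_B θB.symm ⟨p, h2⟩ v)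
        (mfderiv 𝓘(ℝ, E_P) I_B θB.symm ⟨p, h2⟩ w) =
        gB.val (d.glue a) (mfderiv I_A I_B d.glue a v') (mfderiv I_A I_B d.glue a w') := by
      have hgen : ∀ (x : B), x = d.glue a → ∀ (v₀ w₀ : TangentSpace I_B x)
          (v₁ w₁ : TangentSpace I_B (d.glue a)), v₀ = v₁ → w₀ = w₁ →
          gB.val x v₀ w₀ = gB.val (d.glue a) v₁ w₁ := by
        rintro x rfl v₀ w₀ v₁ w₁ rfl rfl
        rfl
      exact hgen _ hbg _ _ _ _ hvB hwB
    show gA.val a v' w' = gB.val (θB.symm ⟨p, h2⟩) (mfderiv 𝓘(ℝ, E_P) I_B θB.symm ⟨p, h2⟩ v)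
      (mfderiv 𝓘(ℝ, E_P) I_B θB.symm ⟨p, h2⟩ w)
    rw [key]
    exact (hiso a hsrc v' w').symm
  -- glue
  let U : Bool → Opens d.Glued := fun i ↦ cond i UA UB
  let g : ∀ i, PseudoRiemannianMetric 𝓘(ℝ, E_P) ∞ E_P (TangentSpace 𝓘(ℝ, E_P) : U i → Type _) :=
    fun i ↦ match i with
      | true => g₁
      | false => g₂
  have hcover : ∀ p : d.Glued, ∃ i, p ∈ U i := fun p ↦ by
    obtain (⟨a, rfl⟩ | ⟨b, rfl⟩) := d.exists_inl_or_inr p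
    · exact ⟨true, ⟨a, rfl⟩⟩
    · exact ⟨false, ⟨b, rfl⟩⟩
  have hcompat' : ∀ i j (p : d.Glued) (hi : p ∈ U i) (hj : p ∈ U j),
      ((g i).val ⟨p, hi⟩ : E_P →L[ℝ] E_P →L[ℝ] ℝ) = (g j).val ⟨p, hj⟩ := by
    rintro (_ | _) (_ | _) p hi hj
    · rfl
    · exact (hcompat p hj hi).symm
    · exact hcompat p hi hj
    · rfl
  obtain ⟨gX, hgX⟩ := OpenSubmanifold.exists_pseudoRiemannianMetric_of_openCover U hcover g hcompat'
  refine ⟨gX, fun a v w ↦ ?_, fun b v w ↦ ?_⟩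
  · have h := hgX true (θA a)
    have key : ∀ (q : d.Glued), q = d.inl a →
        (gX.val q : E_P →L[ℝ] E_P →L[ℝ] ℝ) = g₁.val (θA a) →
        gX.val (d.inl a) (mfderiv I_A 𝓘(ℝ, E_P) d.inl a v) (mfderiv I_A 𝓘(ℝ, E_P) d.inl a w) =
          gA.val a v w := by
      rintro q rfl hq
      have h'' := DFunLike.congr_fun (DFunLike.congr_fun hq (mfderiv I_A 𝓘(ℝ, E_P) d.inl a v))
        (mfderiv I_A 𝓘(ℝ, E_P) d.inl a w)
      rw [h'']
      change gA.val (θA.symm (θA a))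
          (mfderiv 𝓘(ℝ, E_P) I_A θA.symm (θA a) (mfderiv I_A 𝓘(ℝ, E_P) d.inl a v))
          (mfderiv 𝓘(ℝ, E_P) I_A θA.symm (θA a) (mfderiv I_A 𝓘(ℝ, E_P) d.inl a w)) = gA.val a v w
      rw [d.mfderiv_inl_eq_of_diffeomorph θA hθA a v, d.mfderiv_inl_eq_of_diffeomorph θA hθA a w,
        mfderiv_symm_apply_mfderiv θA a v, mfderiv_symm_apply_mfderiv θA a w]
      have hpoint : ∀ (x : A), x = a → ∀ v₀ w₀ : TangentSpace I_A a,
          gA.val x v₀ w₀ = gA.val a v₀ w₀ := by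
        rintro x rfl v₀ w₀
        rfl
      exact hpoint _ (θA.symm_apply_apply a) v w
    exact key _ (hθA a) h
  · have h := hgX false (θB b)
    have key : ∀ (q : d.Glued), q = d.inr b →
        (gX.val q : E_P →L[ℝ] E_P →L[ℝ] ℝ) = g₂.val (θB b) →
        gX.val (d.inr b) (mfderiv I_B 𝓘(ℝ, E_P) d.inr b v) (mfderiv I_B 𝓘(ℝ, E_P) d.inr b w) =
          gB.val b v w := by
      rintro q rfl hq
      have h'' := DFunLike.congr_fun (DFunLike.congr_fun hq (mfderiv I_B 𝓘(ℝ, E_P) d.inr b v))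
        (mfderiv I_B 𝓘(ℝ, E_P) d.inr b w)
      rw [h'']
      change gB.val (θB.symm (θB b))
          (mfderiv 𝓘(ℝ, E_P) I_B θB.symm (θB b) (mfderiv I_B 𝓘(ℝ, E_P) d.inr b v))
          (mfderiv 𝓘(ℝ, E_P) I_B θB.symm (θB b) (mfderiv I_B 𝓘(ℝ, E_P) d.inr b w)) = gB.val b v w
      rw [d.mfderiv_inr_eq_of_diffeomorph θB hθB b v, d.mfderiv_inr_eq_of_diffeomorph θB hθB b w,
        mfderiv_symm_apply_mfderiv θB b v, mfderiv_symm_apply_mfderiv θB b w]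
      have hpoint : ∀ (x : B), x = b → ∀ v₀ w₀ : TangentSpace I_B b,
          gB.val x v₀ w₀ = gB.val b v₀ w₀ := by
        rintro x rfl v₀ w₀
        rfl
      exact hpoint _ (θB.symm_apply_apply b) v w
    exact key _ (hθB b) h

/-- **Positivity descends**: a metric `g` on the glued manifold with `inl^* g = g_A`,
`inr^* g = g_B` is Riemannian when `g_A` and `g_B` are (every point is `inl a` or `inr b`, and
the differentials of `inl`, `inr` are onto). [folklore] -/
theorem isRiemannian_of_glue
    (gA : PseudoRiemannianMetric I_A ∞ E_A (TangentSpace I_A : A → Type _))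
    (gB : PseudoRiemannianMetric I_B ∞ E_B (TangentSpace I_B : B → Type _))
    (g : PseudoRiemannianMetric 𝓘(ℝ, E_P) ∞ E_P (TangentSpace 𝓘(ℝ, E_P) : d.Glued → Type _))
    (hA : ∀ (a : A) (v w : TangentSpace I_A a),
      g.val (d.inl a) (mfderiv I_A 𝓘(ℝ, E_P) d.inl a v) (mfderiv I_A 𝓘(ℝ, E_P) d.inl a w) =
        gA.val a v w)
    (hB : ∀ (b : B) (v w : TangentSpace I_B b),
      g.val (d.inr b) (mfderiv I_B 𝓘(ℝ, E_P) d.inr b v) (mfderiv I_B 𝓘(ℝ, E_P) d.inr b w) =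
        gB.val b v w)
    (hgA : gA.IsRiemannian) (hgB : gB.IsRiemannian) : g.IsRiemannian := by
  intro p u hu
  obtain (⟨a, rfl⟩ | ⟨b, rfl⟩) := d.exists_inl_or_inr p
  · obtain ⟨v, rfl⟩ := (d.mfderiv_inl_bijective a).2 u
    have hv : v ≠ 0 := fun h ↦ hu (by rw [h, map_zero])
    rw [hA a v v]
    exact hgA a v hv
  · obtain ⟨v, rfl⟩ := (d.mfderiv_inr_bijective b).2 u
    have hv : v ≠ 0 := fun h ↦ hu (by rw [h, map_zero])
    rw [hB b v v]
    exact hgB b v hv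

end SmoothGlueData

end Literature.Topology.FourManifolds

end
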